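import Mathlib.FieldTheory.PrimitiveElement
import Mathlib.FieldTheory.Galois.Basic
import Mathlib.NumberTheory.NumberField.InfinitePlace.Embeddings
import HarnessLib

/-!
# Subgroups of `Aut(ℂ)` containing `Aut(ℂ/E)`, `E ⊂ ℂ` a number field, are closed:
# `H = Aut(ℂ/Fix(H))`

Topic `FieldTheory/AlgClosed`; theorems only (no definitions, no named facts), a sequel of
`AutFixedSubfield.lean` ("the fixed field of `Aut(ℂ/F)` is `F`" for countable `F ⊆ ℂ`).

For the transcendental extension `ℂ/ℚ` the Galois correspondence `H ↦ Fix(H)`,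
`R ↦ Aut(ℂ/R)` is far from bijective: a subgroup `H ≤ Aut(ℂ) = (ℂ ≃ₐ[ℚ] ℂ)` is in general
strictly smaller than `Aut(ℂ/Fix(H))` (e.g. the automorphisms fixing all but finitely many of
`√2, √3, √5, …` form a proper subgroup with fixed field `ℚ`). What survives — and what descent
arguments over number fields use ("`ℚ(π_f)` is the fixed field of `{σ : ^σπ_f ≅ π_f}`", and
"`^σπ_f ≅ π_f` for every `σ ∈ Aut(ℂ/ℚ(π_f))`" once `π_f` is defined over a number field;
Clozel 1990, §3.1 and Thm. 3.13) — is the case of subgroups of **finite level**: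

* `Complex.mem_subgroup_of_fix_fixedField` — if `H` contains `Aut(ℂ/E)` for a subfield
  `E ⊆ ℂ` finite over `ℚ`, then every automorphism of `ℂ` fixing `Fix(H)` pointwise lies in
  `H`;
* `Complex.fixingSubgroup_fixedField_eq` — equivalently `Aut(ℂ/Fix(H)) = H`
  (Mathlib's `IntermediateField.fixingSubgroup_fixedField` is the case `E/F` finite
  dimensional, not applicable to `ℂ/ℚ`).

Proof (finite Galois theory inside `Aut(ℂ)`; no extension of automorphisms is needed): let `θ`
be a primitive element of `E/ℚ` and `B` the `H`-orbit of the inclusion `E ⊆ ℂ` among the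
finitely many embeddings `E → ℂ`. The orbit polynomial `q = ∏_{φ ∈ B} (X - φ θ)` is
`H`-invariant, so its coefficients lie in `Fix(H)`; an automorphism `σ` fixing `Fix(H)` fixes
`q`, hence maps the root `θ` to a root `φ θ`, `φ = h|_E`, `h ∈ H`; then `σ = h` on `E = ℚ(θ)`,
i.e. `h⁻¹σ ∈ Aut(ℂ/E) ≤ H`, and `σ ∈ H`. (Lang, *Algebra*, Ch. VI §1, Artin's theorem
(Thm. 1.8), run for the finite `H`-set `B`.)

## References

* S. Lang, *Algebra*, rev. 3rd ed., GTM 211, Springer 2002, Ch. VI §1 (Thm. 1.8, Artin),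
  Ch. V §4 (primitive element). [Lang2002]
* L. Clozel, *Motifs et formes automorphes: applications du principe de fonctorialité*, in
  Automorphic forms, Shimura varieties, and L-functions I (Ann Arbor 1988), Academic Press
  1990, §3.1. [Clozel1990]
-/

noncomputable section

open Polynomial IntermediateField
open scoped Classical

namespace Literature.FieldTheory.AlgClosed

/-- **A subgroup of `Aut(ℂ)` containing `Aut(ℂ/E)` for a number field `E ⊆ ℂ` is closed.** Let
`H ≤ Aut(ℂ) = (ℂ ≃ₐ[ℚ] ℂ)` contain every automorphism fixing pointwise a subfield `E ⊆ ℂ` that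
is finite over `ℚ`. Then every automorphism `σ` of `ℂ` fixing the fixed field `Fix(H)` pointwise
belongs to `H`. (Orbit polynomial of the `H`-orbit of `E ↪ ℂ` at a primitive element of `E`;
Lang, *Algebra*, VI §1.) [cite: Lang2002, Ch. VI §1, Thm. 1.8] -/
theorem Complex.mem_subgroup_of_fix_fixedField (H : Subgroup (ℂ ≃ₐ[ℚ] ℂ)) (E : Subfield ℂ)
    [FiniteDimensional ℚ E] (hE : ∀ τ : ℂ ≃ₐ[ℚ] ℂ, (∀ x ∈ E, τ x = x) → τ ∈ H)
    {σ : ℂ ≃ₐ[ℚ] ℂ} (hσ : ∀ z ∈ fixedField H, σ z = z) : σ ∈ H := by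
  haveI : NumberField E := { to_charZero := inferInstance, to_finiteDimensional := ‹_› }
  let pb := Field.powerBasisOfFiniteOfSeparable ℚ E
  /- (1) The `H`-orbit `B` of the inclusion among the embeddings `E →+* ℂ` (a finite set). -/
  set B : Finset (E →+* ℂ) :=
    Finset.univ.filter fun φ ↦ ∃ h ∈ H, φ = (h : ℂ →+* ℂ).comp E.subtype with hB_def
  have hmemB : ∀ φ, φ ∈ B ↔ ∃ h ∈ H, φ = (h : ℂ →+* ℂ).comp E.subtype := fun φ ↦ by
    simp [hB_def]
  have hιB : E.subtype ∈ B := (hmemB _).mpr ⟨1, H.one_mem, RingHom.ext fun _ ↦ rfl⟩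
  /- (2) The orbit polynomial `q` at the primitive element `θ`; it is invariant under every
  automorphism mapping `B` into itself, in particular under `H`. -/
  set q : ℂ[X] := ∏ φ ∈ B, (X - C (φ pb.gen)) with hq_def
  have hqmap : ∀ g : ℂ ≃ₐ[ℚ] ℂ, (∀ φ ∈ B, (g : ℂ →+* ℂ).comp φ ∈ B) →
      q.map (g : ℂ →+* ℂ) = q := by
    intro g hg
    have hinj : Set.InjOn (fun φ : E →+* ℂ ↦ (g : ℂ →+* ℂ).comp φ) ↑B :=
      fun φ₁ _ φ₂ _ h ↦ RingHom.ext fun x ↦ g.injective (RingHom.congr_fun h x :)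
    have himage : B.image (fun φ : E →+* ℂ ↦ (g : ℂ →+* ℂ).comp φ) = B :=
      Finset.eq_of_subset_of_card_le (Finset.image_subset_iff.mpr hg)
        (Finset.card_image_of_injOn hinj).ge
    rw [hq_def, Polynomial.map_prod]
    conv_rhs => rw [← himage]
    rw [Finset.prod_image hinj]
    refine Finset.prod_congr rfl fun φ _ ↦ ?_
    simp only [Polynomial.map_sub, Polynomial.map_X, Polynomial.map_C, RingHom.comp_apply]
  have hqH : ∀ h ∈ H, q.map (h : ℂ →+* ℂ) = q := fun h hh ↦ hqmap h fun φ hφ ↦ by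
    obtain ⟨h', hh', rfl⟩ := (hmemB φ).mp hφ
    exact (hmemB _).mpr ⟨h * h', H.mul_mem hh hh', RingHom.ext fun _ ↦ rfl⟩
  /- (3) Hence the coefficients of `q` lie in `Fix(H)` and `σ` fixes `q`. -/
  have hqσ : q.map (σ : ℂ →+* ℂ) = q := by
    ext k
    rw [Polynomial.coeff_map]
    refine hσ _ ((mem_fixedField_iff H _).mpr fun h hh ↦ ?_)
    have e := congrArg (fun p : ℂ[X] ↦ p.coeff k) (hqH h hh)
    simpa [Polynomial.coeff_map] using e
  /- (4) `θ` is a root of `q`, hence so is `σ θ`: `σ θ = φ θ` for some `φ = h|_E`, `h ∈ H`. -/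
  have hqθ : q.eval (pb.gen : ℂ) = 0 := by
    rw [hq_def, Polynomial.eval_prod]
    exact Finset.prod_eq_zero hιB (by simp)
  have hqσθ : q.eval (σ (pb.gen : ℂ)) = 0 := by
    have e : q.eval₂ (σ : ℂ →+* ℂ) ((σ : ℂ →+* ℂ) (pb.gen : ℂ)) = 0 := by
      rw [Polynomial.eval₂_hom, hqθ, map_zero]
    rw [← hqσ, Polynomial.eval_map]
    exact e
  obtain ⟨φ, hφB, hφθ⟩ : ∃ φ ∈ B, σ (pb.gen : ℂ) = φ pb.gen := by
    rw [hq_def, Polynomial.eval_prod, Finset.prod_eq_zero_iff] at hqσθ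
    obtain ⟨φ, hφ, h0⟩ := hqσθ
    exact ⟨φ, hφ, by simpa [sub_eq_zero] using h0⟩
  obtain ⟨h, hh, rfl⟩ := (hmemB φ).mp hφB
  /- (5) `σ = h` on `E = ℚ(θ)`, so `h⁻¹σ ∈ Aut(ℂ/E) ≤ H` and `σ ∈ H`. -/
  have hσE : (σ : ℂ →+* ℂ).comp E.subtype = (h : ℂ →+* ℂ).comp E.subtype := by
    have e : ((σ : ℂ →+* ℂ).comp E.subtype).toRatAlgHom =
        ((h : ℂ →+* ℂ).comp E.subtype).toRatAlgHom :=
      pb.algHom_ext (by simpa using hφθ)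
    have e' := congrArg AlgHom.toRingHom e
    simpa [RingHom.toRatAlgHom_toRingHom] using e'
  have hfix : ∀ x ∈ E, (h⁻¹ * σ) x = x := fun x hx ↦ by
    have e : σ x = h x := RingHom.congr_fun hσE ⟨x, hx⟩
    rw [AlgEquiv.mul_apply, e, AlgEquiv.aut_inv, AlgEquiv.symm_apply_apply]
  have hmem : h⁻¹ * σ ∈ H := hE _ hfix
  simpa using H.mul_mem hh hmem

/-- **`Aut(ℂ/Fix(H)) = H` for subgroups of finite level.** With `H` and `E` as in
`Complex.mem_subgroup_of_fix_fixedField`, the subgroup of `Aut(ℂ)` fixing the fixed field of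
`H` is `H` itself (the inclusion `H ≤ Aut(ℂ/Fix(H))` being formal,
`IntermediateField.le_iff_le`). [cite: Lang2002, Ch. VI §1, Thm. 1.8] -/
theorem Complex.fixingSubgroup_fixedField_eq (H : Subgroup (ℂ ≃ₐ[ℚ] ℂ)) (E : Subfield ℂ)
    [FiniteDimensional ℚ E] (hE : ∀ τ : ℂ ≃ₐ[ℚ] ℂ, (∀ x ∈ E, τ x = x) → τ ∈ H) :
    (fixedField H).fixingSubgroup = H := by
  refine le_antisymm (fun σ hσ ↦ ?_) ((le_iff_le _ _).mp le_rfl)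
  exact Complex.mem_subgroup_of_fix_fixedField H E hE
    ((mem_fixingSubgroup_iff (fixedField H) σ).mp hσ)

end Literature.FieldTheory.AlgClosed
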